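import Literature.Probability.MarkovChains.PathCoupling

/-!
HONEST FRAMING: exact (Metropolis-corrected) sampling algorithms for lattice gauge theory; figures
of merit are autocorrelation/cost numbers at stated couplings and volumes; no continuum-physics
claim.

# WeightedPathCoupling — BUBLEY–DYER FOR A WEIGHTED GRAPH WITHOUT ATTAINED GEODESICS: IF `d` IS BELOW EVERY PATH LENGTH AND APPROXIMABLE BY PATH LENGTHS (THE PATH
# PSEUDO-METRIC OF EDGE LENGTHS `ℓ`), THEN `d ≥ 0`, `d(x,x) = 0`, TRIANGLE, `d ≥ 1` OFF THE DIAGONAL WHEN `ℓ ≥ 1`, AND EDGE CONTRACTION `E_θ d(X₁,Y₁) ≤ c·ℓ(x,y)` FOR EVERY EDGE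
# GIVES `ρ_K(P(x,·),P(y,·)) ≤ c·d(x,y)` FOR ALL PAIRS, HENCE `d(t) ≤ cᵗ·diam_d` — SUCH A `d` EXISTS AS SOON AS THE GRAPH IS CONNECTED (lean-2 GEN-37, ours)

Venture-side (OURS).  Cell `lqcd-flow` (pub-lqcd), unit `pub-lqcd-lean-2-g37`, 2026-08-29.  Chapter W (item 1 (i) at finite swap odds), file 17 — the generic half of MEMO-gen37's
reduction (R1): with the product potential `Ψ = Δ·Φ` of chapters V∕W, the law needs the contraction criterion on ADJACENT equal-hub pairs only.  The tree's
`Literature/Probability/MarkovChains/PathCoupling` (LPW Thm 14.6) takes the path metric `ρ` with an ATTAINED minimising path as hypotheses; here the path pseudo-metric is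
handled through the two properties that define an infimum — `d(x,y) ≤ L` for every `E`-path `x ⇝ y` of `ℓ`-length `L` (`hle`) and, for every `ε > 0`, an `E`-path of `ℓ`-length
`≤ d(x,y) + ε` (`happrox`) — from which: `d ≥ 0`, `d(x,x) = 0`, the triangle inequality (concatenation of `IsGraphPath`s), `d(x,y) ≥ 1` for `x ≠ y` when `ℓ ≥ 1` on edges, and the
propagation of EDGE contraction measured against the EDGE LENGTH (`E_θ[d(X₁,Y₁)] ≤ c·ℓ(x,y)`, the form the adjacent-pair criterion delivers) to `ρ_K(P(x,·),P(y,·)) ≤ c·d(x,y)`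
for all pairs (induction along an `ε`-good path with LPW Lemma 14.3, then `ε → 0`), hence (LPW (14.7), (14.10)–(14.11), tree) `d(t) ≤ cᵗ·diam_d`.  Existence of such a `d` for a
connected `E` with `ℓ ≥ 0` (`exists_wpath`, the infimum over path lengths) is proved so that users need no definition.  Hypothesis-functions, no definitions.

## What is proved

* §1 `graphPath_cast`, `graphPath_append`, `graphPath_length_nonneg`, `graphPath_length_ge_one`.
* §2 `wpath_nonneg`, `wpath_self`, `wpath_triangle`, `wpath_ge_one`, `wpath_le_edge`.
* §3 **`wpath_transportDist_le`** (`ρ_K(P(x,·),P(y,·)) ≤ c·d(x,y)` from edge contraction against `ℓ`), **`wpath_worstTvDist_le`** (`d(t) ≤ cᵗ·diam_d`).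
* §4 **`exists_wpath`**.

Reading (no numerics implied): generic plumbing.  Literature grade (cell rule): the mechanism is Bubley–Dyer 1997 ∕ LPW §14.2, already cited in the tree's Literature file; this file
only re-plumbs it (OURS, elementary); nothing new is cited; no new bib keys.
-/

open Finset
open Literature.Probability.MarkovChains

namespace Summit.Ventures.LatticeQCDFlow.Scaling

section GraphPath
variable {X : Type*} {E : X → X → Prop} {ℓ : X → X → ℝ}

/-- Transport of the length index along an equality. [ours] -/
theorem graphPath_cast {x y : X} {L L' : ℝ} (h : IsGraphPath E ℓ x y L) (e : L = L') : IsGraphPath E ℓ x y L' := e ▸ h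

/-- **Concatenation of paths** (lengths add). [ours] -/
theorem graphPath_append {x y z : X} {L₁ L₂ : ℝ} (h₁ : IsGraphPath E ℓ x y L₁) (h₂ : IsGraphPath E ℓ y z L₂) : IsGraphPath E ℓ x z (L₁ + L₂) := by
  induction h₁ with
  | nil x => exact graphPath_cast h₂ (by ring)
  | @cons a m b L hE _ ih => exact graphPath_cast (IsGraphPath.cons hE (ih h₂)) (by ring)

/-- Path lengths are non-negative when edge lengths are. [ours] -/
theorem graphPath_length_nonneg (hℓ : ∀ a b, E a b → 0 ≤ ℓ a b) {x y : X} {L : ℝ} (h : IsGraphPath E ℓ x y L) : 0 ≤ L := by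
  induction h with
  | nil x => exact le_rfl
  | @cons a m b L hE _ ih => exact add_nonneg (hℓ a m hE) ih

/-- A path between DISTINCT points has length `≥ 1` when every edge has length `≥ 1`. [ours] -/
theorem graphPath_length_ge_one (hℓ : ∀ a b, E a b → 1 ≤ ℓ a b) {x y : X} {L : ℝ} (h : IsGraphPath E ℓ x y L) (hxy : x ≠ y) : 1 ≤ L := by
  induction h with
  | nil x => exact absurd rfl hxy
  | @cons a m b L hE hp _ =>
      have h0 : 0 ≤ L := graphPath_length_nonneg (fun a b hab => (zero_le_one.trans (hℓ a b hab))) hp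
      linarith [hℓ a m hE]

end GraphPath

section WPath
variable {X : Type*} {E : X → X → Prop} {ℓ d : X → X → ℝ}

/-! ## §2 The path pseudo-metric through its two defining properties -/

/-- `d ≥ 0`. [ours] -/
theorem wpath_nonneg (hℓ : ∀ a b, E a b → 0 ≤ ℓ a b) (happrox : ∀ x y ε, 0 < ε → ∃ L, IsGraphPath E ℓ x y L ∧ L ≤ d x y + ε) (x y : X) : 0 ≤ d x y := by
  by_contra h
  have h' : d x y < 0 := lt_of_not_ge h
  obtain ⟨L, hL, hLe⟩ := happrox x y (-(d x y) / 2) (by linarith)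
  have := graphPath_length_nonneg hℓ hL
  linarith

/-- `d(x,x) = 0`. [ours] -/
theorem wpath_self (hℓ : ∀ a b, E a b → 0 ≤ ℓ a b) (hle : ∀ x y L, IsGraphPath E ℓ x y L → d x y ≤ L)
    (happrox : ∀ x y ε, 0 < ε → ∃ L, IsGraphPath E ℓ x y L ∧ L ≤ d x y + ε) (x : X) : d x x = 0 :=
  le_antisymm (hle x x 0 (IsGraphPath.nil x)) (wpath_nonneg hℓ happrox x x)

/-- **Triangle inequality.** [ours] -/
theorem wpath_triangle (hle : ∀ x y L, IsGraphPath E ℓ x y L → d x y ≤ L)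
    (happrox : ∀ x y ε, 0 < ε → ∃ L, IsGraphPath E ℓ x y L ∧ L ≤ d x y + ε) (x y z : X) : d x z ≤ d x y + d y z := by
  refine le_of_forall_pos_le_add fun ε hε => ?_
  obtain ⟨L₁, h₁, h₁e⟩ := happrox x y (ε / 2) (by linarith)
  obtain ⟨L₂, h₂, h₂e⟩ := happrox y z (ε / 2) (by linarith)
  have := hle x z (L₁ + L₂) (graphPath_append h₁ h₂)
  linarith

/-- `d(x,y) ≥ 1` for `x ≠ y` when `ℓ ≥ 1` on edges. [ours] -/
theorem wpath_ge_one (hℓ1 : ∀ a b, E a b → 1 ≤ ℓ a b) (happrox : ∀ x y ε, 0 < ε → ∃ L, IsGraphPath E ℓ x y L ∧ L ≤ d x y + ε)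
    {x y : X} (hxy : x ≠ y) : 1 ≤ d x y := by
  refine le_of_forall_pos_le_add fun ε hε => ?_
  obtain ⟨L, hL, hLe⟩ := happrox x y ε hε
  linarith [graphPath_length_ge_one hℓ1 hL hxy]

/-- `d ≤ ℓ` on edges. [ours] -/
theorem wpath_le_edge (hle : ∀ x y L, IsGraphPath E ℓ x y L → d x y ≤ L) {x y : X} (hxy : E x y) : d x y ≤ ℓ x y := by
  have h := hle x y (ℓ x y + 0) (IsGraphPath.cons hxy (IsGraphPath.nil y))
  simpa using h

/-! ## §3 Edge contraction against the edge length propagates to all pairs -/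

variable [Fintype X]

/-- **`ρ_K(P(x,·),P(y,·)) ≤ c·d(x,y)` FOR ALL PAIRS** from edge contraction `E_θ[d(X₁,Y₁)] ≤ c·ℓ(x,y)` on every edge (`d` as in §2, `c ≥ 0`). [ours] -/
theorem wpath_transportDist_le {P : X → X → ℝ} (hP : IsRowStochastic P)
    (hℓ : ∀ a b, E a b → 0 ≤ ℓ a b) (hle : ∀ x y L, IsGraphPath E ℓ x y L → d x y ≤ L)
    (happrox : ∀ x y ε, 0 < ε → ∃ L, IsGraphPath E ℓ x y L ∧ L ≤ d x y + ε) {c : ℝ} (hc : 0 ≤ c)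
    (hedge : ∀ x y, E x y → ∃ θ, IsCoupling (P x) (P y) θ ∧ transportCost d θ ≤ c * ℓ x y) (x y : X) :
    transportDist d (P x) (P y) ≤ c * d x y := by
  have hd0 : ∀ a b, 0 ≤ d a b := wpath_nonneg hℓ happrox
  have hdd : ∀ a, d a a = 0 := wpath_self hℓ hle happrox
  have hdt : ∀ x y z, d x z ≤ d x y + d y z := wpath_triangle hle happrox
  have hne : ∀ a b, (couplings (P a) (P b)).Nonempty := fun a b => couplings_nonempty (hP.1 a) (hP.1 b) (hP.2 a) (hP.2 b)
  -- along any path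
  have key : ∀ {a b : X} {L : ℝ}, IsGraphPath E ℓ a b L → transportDist d (P a) (P b) ≤ c * L := by
    intro a b L h
    induction h with
    | nil a => rw [mul_zero, transportDist_self hd0 hdd (hP.1 a)]
    | @cons a m b L hE _ ih =>
        obtain ⟨θ, hθ, hθc⟩ := hedge a m hE
        calc transportDist d (P a) (P b) ≤ transportDist d (P a) (P m) + transportDist d (P m) (P b) := LevinPeres2017_lemma_14_3 hdt (hne a m) (hne m b)
          _ ≤ c * ℓ a m + c * L := add_le_add ((transportDist_le hθ).trans hθc) ih
          _ = c * (ℓ a m + L) := by ring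
  -- `ε → 0`
  refine le_of_forall_pos_le_add fun ε hε => ?_
  rcases eq_or_lt_of_le hc with hc0 | hcpos
  · obtain ⟨L, hL, -⟩ := happrox x y 1 one_pos
    have := key hL; rw [← hc0, zero_mul] at this; rw [← hc0, zero_mul]; linarith
  · obtain ⟨L, hL, hLe⟩ := happrox x y (ε / c) (div_pos hε hcpos)
    calc transportDist d (P x) (P y) ≤ c * L := key hL
      _ ≤ c * (d x y + ε / c) := mul_le_mul_of_nonneg_left hLe hc
      _ = c * d x y + ε := by field_simp

/-- **`d(t) ≤ cᵗ · diam_d`** from edge contraction against the edge length (`ℓ ≥ 1` on edges so that `d ≥ 𝟙{x ≠ y}`; stationary probability vector `π`). [ours] -/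
theorem wpath_worstTvDist_le [DecidableEq X] {P : X → X → ℝ} (hP : IsRowStochastic P)
    (hℓ1 : ∀ a b, E a b → 1 ≤ ℓ a b) (hle : ∀ x y L, IsGraphPath E ℓ x y L → d x y ≤ L)
    (happrox : ∀ x y ε, 0 < ε → ∃ L, IsGraphPath E ℓ x y L ∧ L ≤ d x y + ε) {c : ℝ} (hc : 0 ≤ c)
    (hedge : ∀ x y, E x y → ∃ θ, IsCoupling (P x) (P y) θ ∧ transportCost d θ ≤ c * ℓ x y)
    {π : X → ℝ} (hπ : ∀ a, 0 ≤ π a) (hπ1 : ∑ a, π a = 1) (hπP : IsStationary π P) (t : ℕ) :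
    worstTvDist P π t ≤ c ^ t * rhoDiam d := by
  have hℓ : ∀ a b, E a b → 0 ≤ ℓ a b := fun a b h => zero_le_one.trans (hℓ1 a b h)
  have hd0 : ∀ a b, 0 ≤ d a b := wpath_nonneg hℓ happrox
  have hd1 : ∀ a b, a ≠ b → 1 ≤ d a b := fun a b hab => wpath_ge_one hℓ1 happrox hab
  refine worstTvDist_le_of_contraction hP hd0 hd1 hc (fun μ ν hμ hν hμ1 hν1 => ?_) hπ hπ1 hπP t
  refine transportDist_stepLaw_le_of_forall (fun x y => ?_) (couplings_nonempty hμ hν hμ1 hν1)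
  obtain ⟨θ, hθ, hθe⟩ := exists_optimalCoupling d (hP.1 x) (hP.1 y) (hP.2 x) (hP.2 y)
  exact ⟨θ, hθ, hθe ▸ wpath_transportDist_le hP hℓ hle happrox hc hedge x y⟩

end WPath

/-! ## §4 Existence of the path pseudo-metric -/

section Exists
variable {X : Type*} {E : X → X → Prop} {ℓ : X → X → ℝ}

/-- **The infimum of path lengths** has the two defining properties (connected `E`, `ℓ ≥ 0` on edges). [ours] -/
theorem exists_wpath (hℓ : ∀ a b, E a b → 0 ≤ ℓ a b) (hconn : ∀ x y, ∃ L, IsGraphPath E ℓ x y L) :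
    ∃ d : X → X → ℝ, (∀ x y L, IsGraphPath E ℓ x y L → d x y ≤ L) ∧ (∀ x y ε, 0 < ε → ∃ L, IsGraphPath E ℓ x y L ∧ L ≤ d x y + ε) := by
  classical
  refine ⟨fun x y => sInf {L | IsGraphPath E ℓ x y L}, fun x y L hL => ?_, fun x y ε hε => ?_⟩
  · exact csInf_le ⟨0, fun L' hL' => graphPath_length_nonneg hℓ hL'⟩ hL
  · have hne : ({L | IsGraphPath E ℓ x y L} : Set ℝ).Nonempty := by obtain ⟨L, hL⟩ := hconn x y; exact ⟨L, hL⟩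
    obtain ⟨L, hL, hLlt⟩ := exists_lt_of_csInf_lt hne (lt_add_of_pos_right _ hε)
    exact ⟨L, hL, hLlt.le⟩

end Exists

end Summit.Ventures.LatticeQCDFlow.Scaling
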